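import Literature.Analysis.FluidPDE.PeriodicOseenSliceFourier
import Literature.Analysis.FluidPDE.OseenDuhamelEnvelopeCalculus
import Literature.Analysis.FluidPDE.OseenDuhamelPairCalculus
import Literature.Analysis.FunctionSpaces.TorusVectorParseval
import Literature.Analysis.FunctionSpaces.TorusHeatSmoothing
import Literature.Analysis.FunctionSpaces.TorusInverseLaplacian
import Mathlib.MeasureTheory.Integral.MeanInequalities
import HarnessLib

/-!
# The `Ḣ⁻¹(𝕋ᵈ)` norm of the Duhamel term of periodic fields under a slice-wise envelope

Analysis/FluidPDE support file (everything proved) for the perturbation step of M. P. Coiculescu,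
S. Palasek, *Non-uniqueness of smooth solutions of the Navier–Stokes equations from critical data*,
Invent. Math. 244 (2025) = arXiv:2503.14699, Prop. 4.3 (`w⁽ⁱ⁾(t) → 0` as `t → 0`; printed in the
negative Hölder space `𝒞^{-1+α/2}`) and §5 (the two solutions attain the same datum): in the
tree's rendering (`CriticalDataSmoothNonuniqueness`: `Ḣ⁻¹(𝕋³)`) one needs
`‖w(t)‖_{Ḣ⁻¹} → 0`, where `w(t)` is a sum of Duhamel terms
`B¹_0(a,b)(t) = ∫₀ᵗ e^{(t-τ)Δ}ℙ∇·(a ⊗ b) dτ` of periodic fields with integrable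
`‖a(τ)‖_∞‖b(τ)‖_∞`. Since `e^{(t-τ)Δ}ℙ∇·` gains the derivative that `Ḣ⁻¹` forgives, the natural
estimate is `‖B¹_{t₀}(a,b)(t)‖_{Ḣ⁻¹(𝕋ᵈ)} ≲ ∫ ‖a(τ) ⊗ b(τ)‖_{L²(𝕋ᵈ)} dτ ≤ ∫ M_a M_b dτ`; this file
proves it on the Fourier side (the tree's `Ḣ⁻¹` seminorm `Torus.eHomSobolevSeminorm (-1)` is
spectral):

* `Torus.mFourierCoeff_inner_oseenDuhamel_repr_eq_setIntegral` — the torus Fourier coefficients of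
  `⟪B¹_{t₀}(a,b)(t) ∘ repr, w⟫` are the time integrals of those of the slices;
* `Torus.eHomSobolevSeminorm_neg_one_oseenDuhamel_repr_le` —
  `‖B¹_{t₀}(a,b)(t) ∘ repr‖_{Ḣ⁻¹(𝕋ᵈ)} ≤ 2π (#d)³ ∫_{(t₀,t)} M_a M_b`
  (Koch–Tataru's symbol bound `|𝓕K(ξ)| ≤ 2π|ξ|`, `Torus.norm_mFourierCoeff_inner_oseenSlice_lift_repr_le`,
  a weighted Cauchy–Schwarz inequality in time and Parseval on `𝕋ᵈ`).

## References

* H. Koch, D. Tataru, Adv. Math. 157 (2001), §2 (6)–(8). [`KochTataruAdvMath2001`]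
* M. P. Coiculescu, S. Palasek, Invent. Math. 244 (2025) = arXiv:2503.14699, Prop. 4.3, §5.
  [`CoiculescuPalasek2025`]
* L. Grafakos, *Classical Fourier Analysis*, 3rd ed. (2014), Prop. 3.2.7 (Parseval). [folklore]
-/

noncomputable section

open MeasureTheory Set Function Filter TopologicalSpace InnerProductSpace Metric Real UnitAddTorus
open Literature.Analysis.FunctionSpaces Literature.Analysis.FunctionSpaces.Torus
open _root_.Topology
open scoped RealInnerProductSpace NNReal ENNReal FourierTransform

namespace Literature.Analysis.FluidPDE

namespace Torus

variable {d : Type*} [Fintype d] [DecidableEq d]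

/-! ### Measurability of parametrised Fourier coefficients -/

omit [DecidableEq d] in
/-- Fourier coefficients of a jointly measurable family are measurable in the parameter. [folklore] -/
theorem stronglyMeasurable_mFourierCoeff_param {F : ℝ → UnitAddTorus d → ℂ}
    (hF : Measurable (uncurry F)) (k : d → ℤ) :
    StronglyMeasurable fun τ => mFourierCoeff (F τ) k := by
  have h : (fun τ => mFourierCoeff (F τ) k) = fun τ => ∫ x, mFourier (-k) x • F τ x := by
    funext τ; exact mFourierCoeff_eq_integral_volume _ _
  rw [h]
  refine StronglyMeasurable.integral_prod_right (f := fun τ x => mFourier (-k) x • F τ x) ?_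
  exact (((mFourier (-k)).continuous.measurable.comp measurable_snd).smul hF).stronglyMeasurable

/-! ### Parseval bound for a product of bounded continuous factors -/

omit [DecidableEq d] in
/-- `Σₖ |𝓕_𝕋(g)(k)|² ≤ C²` in `ℝ≥0∞` for a continuous `g : 𝕋ᵈ → ℂ` with `‖g‖ ≤ C` (Parseval and
`|𝕋ᵈ| = 1`). [folklore] -/
theorem tsum_ofReal_norm_sq_mFourierCoeff_le {g : UnitAddTorus d → ℂ} (hg : Continuous g) {C : ℝ}
    (hC : ∀ x, ‖g x‖ ≤ C) :
    ∑' k : d → ℤ, ENNReal.ofReal (‖mFourierCoeff g k‖ ^ 2) ≤ ENNReal.ofReal (C ^ 2) := by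
  have hC0 : 0 ≤ C := (norm_nonneg _).trans (hC 0)
  have hmem : MemLp g 2 volume :=
    MemLp.of_bound hg.aestronglyMeasurable C (Eventually.of_forall hC)
  have h := hasSum_sq_norm_mFourierCoeff hmem
  rw [← ENNReal.ofReal_tsum_of_nonneg (fun k => sq_nonneg _) h.summable, h.tsum_eq]
  refine ENNReal.ofReal_le_ofReal ?_
  have hle : ∀ x, ‖g x‖ ^ 2 ≤ C ^ 2 := fun x => pow_le_pow_left₀ (norm_nonneg _) (hC x) 2
  calc ∫ x, ‖g x‖ ^ 2 ≤ ∫ _ : UnitAddTorus d, C ^ 2 :=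
        integral_mono_of_nonneg (Eventually.of_forall fun x => sq_nonneg _) (integrable_const (C ^ 2))
          (Eventually.of_forall hle)
    _ = C ^ 2 := by simp

/-! ### The Fourier coefficients of the Duhamel term -/

variable {a b : ℝ → EuclideanSpace ℝ d → EuclideanSpace ℝ d}
  {A B : ℝ → UnitAddTorus d → EuclideanSpace ℝ d} {t₀ t : ℝ} {Ma Mb : ℝ → ℝ}

omit [DecidableEq d] in
/-- **The torus Fourier coefficients of the paired Duhamel term are time integrals of those of
the slices**: under an integrable envelope,
`𝓕_𝕋(⟪B¹_{t₀}(a,b)(t)∘repr, w⟫)(k) = ∫_{(t₀,t)} 𝓕_𝕋(⟪N_{t-τ}[a(τ),b(τ)]∘repr, w⟫)(k) dτ` (Fubini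
over `𝕋ᵈ × (t₀, t)` under `‖N_{t-τ}[a,b]‖ ≤ C₀(t-τ)^{-1/2}M_aM_b`). [folklore] -/
theorem mFourierCoeff_inner_oseenDuhamel_repr_eq_setIntegral (ham : Measurable (uncurry a))
    (hbm : Measurable (uncurry b)) (ha : ∀ τ ∈ Ioo t₀ t, ∀ y, ‖a τ y‖ ≤ Ma τ)
    (hb : ∀ τ ∈ Ioo t₀ t, ∀ y, ‖b τ y‖ ≤ Mb τ)
    (henv : IntegrableOn (fun τ => (t - τ) ^ (-(1 / 2 : ℝ)) * (Ma τ * Mb τ)) (Ioo t₀ t))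
    (w : EuclideanSpace ℝ d) (k : d → ℤ) :
    mFourierCoeff (fun x => ((⟪oseenDuhamel 1 t₀ a b t (Torus.repr x), w⟫ : ℝ) : ℂ)) k =
      ∫ τ in Ioo t₀ t, mFourierCoeff
        (fun x => ((⟪oseenSlice (t - τ) (a τ) (b τ) (Torus.repr x), w⟫ : ℝ) : ℂ)) k := by
  haveI : CompleteSpace (EuclideanSpace ℝ d) := FiniteDimensional.complete ℝ _
  -- the pairing as a time integral
  have hD : ∀ x : UnitAddTorus d, ((⟪oseenDuhamel 1 t₀ a b t (Torus.repr x), w⟫ : ℝ) : ℂ) =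
      ∫ τ in Ioo t₀ t, ((⟪oseenSlice (t - τ) (a τ) (b τ) (Torus.repr x), w⟫ : ℝ) : ℂ) := by
    intro x
    rw [oseenDuhamel_one_eq_setIntegral_oseenSlice, real_inner_comm,
      ← integral_inner (integrableOn_oseenSlice_of_envelope ham hbm ha hb henv _) w]
    rw [← integral_complex_ofReal]
    refine integral_congr_ae (Eventually.of_forall fun τ => ?_)
    beta_reduce
    rw [real_inner_comm]
  -- the jointly integrable function on `𝕋ᵈ × (t₀, t)`
  set Φ : UnitAddTorus d → ℝ → ℂ := fun x τ =>
    mFourier (-k) x * ((⟪oseenSlice (t - τ) (a τ) (b τ) (Torus.repr x), w⟫ : ℝ) : ℂ) with hΦ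
  have hint : Integrable (uncurry Φ) ((volume : Measure (UnitAddTorus d)).prod (volume.restrict (Ioo t₀ t))) := by
    refine Integrable.mono'
      (g := fun p => (1 : ℝ) * (oseenSliceConst (EuclideanSpace ℝ d) *
        ((t - p.2) ^ (-(1 / 2 : ℝ)) * (Ma p.2 * Mb p.2)) * ‖w‖))
      ((integrable_const (1 : ℝ)).mul_prod
        ((henv.const_mul (oseenSliceConst (EuclideanSpace ℝ d))).mul_const ‖w‖)) ?_ ?_
    · have hsm := stronglyMeasurable_oseenSlice_duhamel 1 t ham hbm
      have h2 : AEStronglyMeasurable (fun p : UnitAddTorus d × ℝ =>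
          oseenSlice (1 * (t - p.2)) (a p.2) (b p.2) (Torus.repr p.1))
          ((volume : Measure (UnitAddTorus d)).prod (volume.restrict (Ioo t₀ t))) :=
        (hsm.comp_measurable (measurable_snd.prodMk (Torus.measurable_repr.comp measurable_fst))).aestronglyMeasurable
      have h3 : AEStronglyMeasurable (fun p : UnitAddTorus d × ℝ =>
          ((⟪oseenSlice (t - p.2) (a p.2) (b p.2) (Torus.repr p.1), w⟫ : ℝ) : ℂ))
          ((volume : Measure (UnitAddTorus d)).prod (volume.restrict (Ioo t₀ t))) := by
        have h4 : AEStronglyMeasurable (fun p : UnitAddTorus d × ℝ =>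
            ⟪oseenSlice (1 * (t - p.2)) (a p.2) (b p.2) (Torus.repr p.1), w⟫)
            ((volume : Measure (UnitAddTorus d)).prod (volume.restrict (Ioo t₀ t))) := h2.inner_const
        simp only [one_mul] at h4
        exact Complex.continuous_ofReal.comp_aestronglyMeasurable h4
      exact ((mFourier (-k)).continuous.comp continuous_fst).aestronglyMeasurable.mul h3
    · have hmem : ∀ᵐ p ∂((volume : Measure (UnitAddTorus d)).prod (volume.restrict (Ioo t₀ t))),
          p.2 ∈ Ioo t₀ t := by
        have hre : (volume : Measure (UnitAddTorus d)).prod (volume.restrict (Ioo t₀ t)) =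
            ((volume : Measure (UnitAddTorus d)).prod volume).restrict (univ ×ˢ Ioo t₀ t) := by
          rw [← Measure.prod_restrict, Measure.restrict_univ]
        rw [hre]
        filter_upwards [ae_restrict_mem (MeasurableSet.univ.prod measurableSet_Ioo)] with p hp
        exact (mem_prod.1 hp).2
      filter_upwards [hmem] with p hp
      have hσ : 0 < t - p.2 := sub_pos.2 hp.2
      simp only [uncurry, hΦ, norm_mul, Complex.norm_real]
      have he : ‖mFourier (-k) p.1‖ ≤ 1 := ((mFourier (-k)).norm_coe_le_norm p.1).trans_eq mFourier_norm
      have hi : ‖⟪oseenSlice (t - p.2) (a p.2) (b p.2) (Torus.repr p.1), w⟫‖ ≤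
          oseenSliceConst (EuclideanSpace ℝ d) * ((t - p.2) ^ (-(1 / 2 : ℝ)) * (Ma p.2 * Mb p.2)) * ‖w‖ := by
        refine (norm_inner_le_norm _ _).trans (mul_le_mul_of_nonneg_right ?_ (norm_nonneg _))
        calc ‖oseenSlice (t - p.2) (a p.2) (b p.2) (Torus.repr p.1)‖
            ≤ oseenSliceConst (EuclideanSpace ℝ d) * (t - p.2) ^ (-(1 / 2 : ℝ)) * Ma p.2 * Mb p.2 :=
              norm_oseenSlice_le_oseenSliceConst hσ (ha p.2 hp) (hb p.2 hp) _
          _ = _ := by ring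
      exact mul_le_mul he hi (norm_nonneg _) zero_le_one
  calc mFourierCoeff (fun x => ((⟪oseenDuhamel 1 t₀ a b t (Torus.repr x), w⟫ : ℝ) : ℂ)) k
      = ∫ x, ∫ τ in Ioo t₀ t, Φ x τ := by
        rw [mFourierCoeff_eq_integral_volume]
        refine integral_congr_ae (Eventually.of_forall fun x => ?_)
        simp only [hΦ, smul_eq_mul, hD x, ← integral_const_mul]
    _ = ∫ τ in Ioo t₀ t, ∫ x, Φ x τ := integral_integral_swap hint
    _ = ∫ τ in Ioo t₀ t, mFourierCoeff
          (fun x => ((⟪oseenSlice (t - τ) (a τ) (b τ) (Torus.repr x), w⟫ : ℝ) : ℂ)) k := by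
        refine integral_congr_ae (Eventually.of_forall fun τ => ?_)
        simp only [hΦ, mFourierCoeff_eq_integral_volume, smul_eq_mul]

/-! ### The `Ḣ⁻¹` bound -/

omit [DecidableEq d] in
/-- **The `Ḣ⁻¹(𝕋ᵈ)` norm of the Duhamel term of periodic fields under an envelope.** Let `a, b` be
jointly measurable fields on `ℝ × ℝᵈ` whose slices on `(t₀, t)` are lifts of continuous torus
fields, with `‖a τ y‖ ≤ M_a(τ)`, `‖b τ y‖ ≤ M_b(τ)`, `M_a M_b > 0`, and `(t-τ)^{-1/2}M_aM_b`, `M_aM_b`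
integrable on `(t₀, t)`. Then
`‖B¹_{t₀}(a,b)(t) ∘ repr‖_{Ḣ⁻¹(𝕋ᵈ)} ≤ 2π (#d)³ ∫_{(t₀,t)} M_a M_b` for the spectral seminorm
`Torus.eHomSobolevSeminorm (-1)` of the complexified field: by
`Torus.norm_mFourierCoeff_inner_oseenSlice_lift_repr_le` the `k`-th coefficient is at most
`2π|k| ∫ Σⱼₗ |𝓕_𝕋(aⱼbₗ(τ))(k)| dτ`, the weight `|k|⁻²` cancels the symbol, a weighted
Cauchy–Schwarz inequality in `τ` (weight `M_aM_b`) and Parseval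
(`Σₖ|𝓕_𝕋(aⱼbₗ)(k)|² ≤ M_a²M_b²`) finish. This is the estimate
`‖∫ e^{(t-τ)Δ}ℙ∇·(a⊗b)‖_{Ḣ⁻¹} ≲ ∫‖a ⊗ b‖_{L²}` behind "`w(t) → 0`" of Prop. 4.3 in the `Ḣ⁻¹`
rendering. [cite: CoiculescuPalasek2025, Prop. 4.3 and §5; KochTataruAdvMath2001, §2 (6)–(8)] -/
theorem eHomSobolevSeminorm_neg_one_oseenDuhamel_repr_le (ham : Measurable (uncurry a))
    (hbm : Measurable (uncurry b)) (ha : ∀ τ ∈ Ioo t₀ t, ∀ y, ‖a τ y‖ ≤ Ma τ)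
    (hb : ∀ τ ∈ Ioo t₀ t, ∀ y, ‖b τ y‖ ≤ Mb τ)
    (hpos : ∀ τ ∈ Ioo t₀ t, 0 < Ma τ * Mb τ)
    (henv : IntegrableOn (fun τ => (t - τ) ^ (-(1 / 2 : ℝ)) * (Ma τ * Mb τ)) (Ioo t₀ t))
    (hg : IntegrableOn (fun τ => Ma τ * Mb τ) (Ioo t₀ t))
    (hA : ∀ τ ∈ Ioo t₀ t, Continuous (A τ)) (hB : ∀ τ ∈ Ioo t₀ t, Continuous (B τ))
    (hlifta : ∀ τ ∈ Ioo t₀ t, Torus.lift (A τ) = a τ) (hliftb : ∀ τ ∈ Ioo t₀ t, Torus.lift (B τ) = b τ) :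
    Torus.eHomSobolevSeminorm (-1)
        (EuclideanSpace.complexify ∘ fun x : UnitAddTorus d => oseenDuhamel 1 t₀ a b t (Torus.repr x)) ≤
      ENNReal.ofReal (2 * π * (Fintype.card d : ℝ) ^ 3 * ∫ τ in Ioo t₀ t, Ma τ * Mb τ) := by
  classical
  haveI : CompleteSpace (EuclideanSpace ℝ d) := FiniteDimensional.complete ℝ _
  set μ : Measure ℝ := (volume : Measure ℝ).restrict (Ioo t₀ t) with hμ
  set n : ℝ := (Fintype.card d : ℝ) with hn
  have hn0 : 0 ≤ n := by positivity
  set D : UnitAddTorus d → EuclideanSpace ℝ d := fun x => oseenDuhamel 1 t₀ a b t (Torus.repr x) with hDdef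
  set g : ℝ → ℝ := fun τ => Ma τ * Mb τ with hgdef
  set G : ℝ := ∫ τ in Ioo t₀ t, g τ with hGdef
  have hG0 : 0 ≤ G := setIntegral_nonneg measurableSet_Ioo fun τ hτ => (hpos τ hτ).le
  -- the slices of `a, b` on the torus and their products
  have hAeq : ∀ τ ∈ Ioo t₀ t, ∀ x, A τ x = a τ (Torus.repr x) := fun τ hτ x => by
    rw [← hlifta τ hτ, Torus.lift_repr]
  have hBeq : ∀ τ ∈ Ioo t₀ t, ∀ x, B τ x = b τ (Torus.repr x) := fun τ hτ x => by
    rw [← hliftb τ hτ, Torus.lift_repr]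
  set P : d → d → ℝ → UnitAddTorus d → ℂ := fun j l τ x =>
    ((a τ (Torus.repr x) j * b τ (Torus.repr x) l : ℝ) : ℂ) with hPdef
  have hPm : ∀ j l, Measurable (uncurry (P j l)) := by
    intro j l
    have h1 : Measurable fun q : ℝ × UnitAddTorus d => a q.1 (Torus.repr q.2) j :=
      (EuclideanSpace.proj j).continuous.measurable.comp
        (ham.comp (measurable_fst.prodMk (Torus.measurable_repr.comp measurable_snd)))
    have h2 : Measurable fun q : ℝ × UnitAddTorus d => b q.1 (Torus.repr q.2) l :=
      (EuclideanSpace.proj l).continuous.measurable.comp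
        (hbm.comp (measurable_fst.prodMk (Torus.measurable_repr.comp measurable_snd)))
    exact Complex.measurable_ofReal.comp (h1.mul h2)
  set T : d → d → (d → ℤ) → ℝ → ℂ := fun j l k τ => mFourierCoeff (P j l τ) k with hTdef
  have hTm : ∀ j l k, Measurable (T j l k) := fun j l k =>
    (stronglyMeasurable_mFourierCoeff_param (hPm j l) k).measurable
  set h : (d → ℤ) → ℝ → ℝ := fun k τ => ∑ j, ∑ l, ‖T j l k τ‖ with hhdef
  have hhm : ∀ k, Measurable (h k) := fun k =>
    Finset.measurable_sum _ fun j _ => Finset.measurable_sum _ fun l _ => (hTm j l k).norm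
  have hh0 : ∀ k τ, 0 ≤ h k τ := fun k τ =>
    Finset.sum_nonneg fun j _ => Finset.sum_nonneg fun l _ => norm_nonneg _
  -- pointwise bounds of the products
  have hPle : ∀ j l, ∀ τ ∈ Ioo t₀ t, ∀ x, ‖P j l τ x‖ ≤ g τ := by
    intro j l τ hτ x
    simp only [hPdef, Complex.norm_real, norm_mul, hgdef]
    exact mul_le_mul ((PiLp.norm_apply_le _ j).trans (ha τ hτ _)) ((PiLp.norm_apply_le _ l).trans (hb τ hτ _))
      (norm_nonneg _) ((norm_nonneg _).trans (ha τ hτ (Torus.repr x)))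
  have hPcont : ∀ j l, ∀ τ ∈ Ioo t₀ t, Continuous (P j l τ) := by
    intro j l τ hτ
    have h1 : Continuous fun x => a τ (Torus.repr x) j := by
      have := (EuclideanSpace.proj j).continuous.comp (hA τ hτ)
      exact this.congr fun x => by simp [hAeq τ hτ x]
    have h2 : Continuous fun x => b τ (Torus.repr x) l := by
      have := (EuclideanSpace.proj l).continuous.comp (hB τ hτ)
      exact this.congr fun x => by simp [hBeq τ hτ x]
    exact Complex.continuous_ofReal.comp (h1.mul h2)
  have hTle : ∀ j l k, ∀ τ ∈ Ioo t₀ t, ‖T j l k τ‖ ≤ g τ := fun j l k τ hτ =>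
    norm_mFourierCoeff_le_of_forall_norm_le (hPle j l τ hτ) k
  have hhle : ∀ k, ∀ τ ∈ Ioo t₀ t, h k τ ≤ n * n * g τ := by
    intro k τ hτ
    calc h k τ ≤ ∑ _j : d, ∑ _l : d, g τ :=
          Finset.sum_le_sum fun j _ => Finset.sum_le_sum fun l _ => hTle j l k τ hτ
      _ = n * n * g τ := by simp [hn]; ring
  have hhint : ∀ k, Integrable (h k) μ := by
    intro k
    refine (hg.const_mul (n * n)).mono' (hhm k).aestronglyMeasurable ?_
    filter_upwards [ae_restrict_mem measurableSet_Ioo] with τ hτ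
    rw [Real.norm_of_nonneg (hh0 k τ)]
    exact hhle k τ hτ
  -- the slice coefficient bound, slice by slice
  have hslice : ∀ τ ∈ Ioo t₀ t, ∀ (w : EuclideanSpace ℝ d) (k : d → ℤ),
      ‖mFourierCoeff (fun x => ((⟪oseenSlice (t - τ) (a τ) (b τ) (Torus.repr x), w⟫ : ℝ) : ℂ)) k‖ ≤
        2 * π * ‖latticeVec k‖ * ‖w‖ * h k τ := by
    intro τ hτ w k
    have h1 := norm_mFourierCoeff_inner_oseenSlice_lift_repr_le (hA τ hτ) (hB τ hτ)
      (sub_pos.2 hτ.2) w k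
    rw [hlifta τ hτ, hliftb τ hτ] at h1
    refine h1.trans (le_of_eq ?_)
    congr 1
    refine Finset.sum_congr rfl fun j _ => Finset.sum_congr rfl fun l _ => ?_
    simp only [hTdef, hPdef, hAeq τ hτ, hBeq τ hτ]
  -- the coefficient bound for the Duhamel term, component by component
  have hDm : Measurable D :=
    ((measurable_uncurry_oseenDuhamel_from ham hbm 1 t₀).comp
      (measurable_const.prodMk measurable_id)).comp Torus.measurable_repr
  have hDb : ∀ x, ‖D x‖ ≤ oseenSliceConst (EuclideanSpace ℝ d) *
      ∫ τ in Ioo t₀ t, (t - τ) ^ (-(1 / 2 : ℝ)) * (Ma τ * Mb τ) := fun x =>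
    norm_oseenDuhamel_le_setIntegral ha hb henv _
  have hDint : Integrable D volume :=
    (integrable_const _).mono' hDm.aestronglyMeasurable (Eventually.of_forall hDb)
  have hcoef : ∀ (k : d → ℤ) (i : d),
      ‖(mFourierCoeff (EuclideanSpace.complexify ∘ D) k) i‖ ≤
        2 * π * ‖latticeVec k‖ * ∫ τ in Ioo t₀ t, h k τ := by
    intro k i
    rw [mFourierCoeff_complexify_apply hDint k i]
    have hfun : (fun x => ((D x) i : ℂ)) = fun x =>
        ((⟪oseenDuhamel 1 t₀ a b t (Torus.repr x), EuclideanSpace.single i (1 : ℝ)⟫ : ℝ) : ℂ) := by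
      funext x
      simp only [hDdef, EuclideanSpace.inner_single_right, one_mul, conj_trivial]
    rw [hfun, mFourierCoeff_inner_oseenDuhamel_repr_eq_setIntegral ham hbm ha hb henv _ k]
    have hbound : ∀ᵐ τ ∂μ, ‖mFourierCoeff (fun x => ((⟪oseenSlice (t - τ) (a τ) (b τ) (Torus.repr x),
        EuclideanSpace.single i (1 : ℝ)⟫ : ℝ) : ℂ)) k‖ ≤ 2 * π * ‖latticeVec k‖ * h k τ := by
      filter_upwards [ae_restrict_mem measurableSet_Ioo] with τ hτ
      have h1 := hslice τ hτ (EuclideanSpace.single i (1 : ℝ)) k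
      simp only [PiLp.norm_single, norm_one, mul_one] at h1
      exact h1
    refine (norm_integral_le_of_norm_le ((hhint k).const_mul _) hbound).trans (le_of_eq ?_)
    rw [integral_const_mul]
  -- from components to the Euclidean norm, and the weight
  have hterm : ∀ k : d → ℤ, k ≠ 0 →
      ENNReal.ofReal (Torus.freqNormSq k ^ (-1 : ℝ)) *
          ‖mFourierCoeff (EuclideanSpace.complexify ∘ D) k‖ₑ ^ 2 ≤
        ENNReal.ofReal (4 * π ^ 2 * n) * ENNReal.ofReal (∫ τ in Ioo t₀ t, h k τ) ^ 2 := by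
    intro k hk
    set I : ℝ := ∫ τ in Ioo t₀ t, h k τ with hI
    have hI0 : 0 ≤ I := integral_nonneg fun τ => hh0 k τ
    have hfq : 0 < Torus.freqNormSq k := lt_of_lt_of_le one_pos (one_le_freqNormSq_of_ne_zero hk)
    have hnormsq : ‖mFourierCoeff (EuclideanSpace.complexify ∘ D) k‖ ^ 2 ≤
        n * (2 * π * ‖latticeVec k‖ * I) ^ 2 := by
      rw [EuclideanSpace.norm_sq_eq]
      calc ∑ i, ‖(mFourierCoeff (EuclideanSpace.complexify ∘ D) k) i‖ ^ 2
          ≤ ∑ _i : d, (2 * π * ‖latticeVec k‖ * I) ^ 2 :=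
            Finset.sum_le_sum fun i _ => pow_le_pow_left₀ (norm_nonneg _) (hcoef k i) 2
        _ = n * (2 * π * ‖latticeVec k‖ * I) ^ 2 := by simp [hn]
    have hw : Torus.freqNormSq k ^ (-1 : ℝ) * (n * (2 * π * ‖latticeVec k‖ * I) ^ 2) =
        4 * π ^ 2 * n * I ^ 2 := by
      rw [Real.rpow_neg_one, mul_pow, mul_pow, mul_pow, norm_latticeVec_sq]
      field_simp
      ring
    calc ENNReal.ofReal (Torus.freqNormSq k ^ (-1 : ℝ)) * ‖mFourierCoeff (EuclideanSpace.complexify ∘ D) k‖ₑ ^ 2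
        = ENNReal.ofReal (Torus.freqNormSq k ^ (-1 : ℝ)) *
            ENNReal.ofReal (‖mFourierCoeff (EuclideanSpace.complexify ∘ D) k‖ ^ 2) := by
          rw [← ofReal_norm, ENNReal.ofReal_pow (norm_nonneg _)]
      _ ≤ ENNReal.ofReal (Torus.freqNormSq k ^ (-1 : ℝ)) *
            ENNReal.ofReal (n * (2 * π * ‖latticeVec k‖ * I) ^ 2) := by gcongr
      _ = ENNReal.ofReal (4 * π ^ 2 * n * I ^ 2) := by
          rw [← ENNReal.ofReal_mul (Real.rpow_nonneg hfq.le _), hw]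
      _ = ENNReal.ofReal (4 * π ^ 2 * n) * ENNReal.ofReal I ^ 2 := by
          rw [← ENNReal.ofReal_pow hI0, ← ENNReal.ofReal_mul (by positivity)]
  -- the weighted Cauchy–Schwarz inequality in time (in `ℝ≥0∞`)
  set 𝔊 : ℝ≥0∞ := ∫⁻ τ, ENNReal.ofReal (g τ) ∂μ with h𝔊def
  have h𝔊 : 𝔊 = ENNReal.ofReal G := by
    rw [h𝔊def, hGdef, hμ, ofReal_integral_eq_lintegral_ofReal hg
      (ae_restrict_of_forall_mem measurableSet_Ioo fun τ hτ => (hpos τ hτ).le)]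
  have hgm : AEMeasurable g μ := hg.aestronglyMeasurable.aemeasurable
  have hCS : ∀ k, ENNReal.ofReal (∫ τ in Ioo t₀ t, h k τ) ^ 2 ≤
      𝔊 * ∫⁻ τ, ENNReal.ofReal (h k τ ^ 2 / g τ) ∂μ := by
    intro k
    have hsplit : ∀ τ ∈ Ioo t₀ t, ENNReal.ofReal (h k τ) =
        ENNReal.ofReal (Real.sqrt (g τ)) * ENNReal.ofReal (h k τ / Real.sqrt (g τ)) := by
      intro τ hτ
      have hs : 0 < Real.sqrt (g τ) := Real.sqrt_pos.2 (hpos τ hτ)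
      rw [← ENNReal.ofReal_mul (Real.sqrt_nonneg _), mul_div_cancel₀ _ hs.ne']
    have h1 : ENNReal.ofReal (∫ τ in Ioo t₀ t, h k τ) = ∫⁻ τ, ENNReal.ofReal (h k τ) ∂μ := by
      rw [hμ, ofReal_integral_eq_lintegral_ofReal (hhint k) (Eventually.of_forall (hh0 k))]
    have h2 : ∫⁻ τ, ENNReal.ofReal (h k τ) ∂μ =
        ∫⁻ τ, ((fun τ => ENNReal.ofReal (Real.sqrt (g τ))) * fun τ =>
          ENNReal.ofReal (h k τ / Real.sqrt (g τ))) τ ∂μ := by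
      refine lintegral_congr_ae ?_
      filter_upwards [ae_restrict_mem measurableSet_Ioo] with τ hτ
      exact hsplit τ hτ
    have hf1 : AEMeasurable (fun τ => ENNReal.ofReal (Real.sqrt (g τ))) μ :=
      hgm.sqrt.ennreal_ofReal
    have hf2 : AEMeasurable (fun τ => ENNReal.ofReal (h k τ / Real.sqrt (g τ))) μ :=
      ((hhm k).aemeasurable.div hgm.sqrt).ennreal_ofReal
    have hH := ENNReal.lintegral_mul_le_Lp_mul_Lq μ Real.HolderConjugate.two_two hf1 hf2
    have hsq1 : ∫⁻ τ, ENNReal.ofReal (Real.sqrt (g τ)) ^ (2 : ℝ) ∂μ = 𝔊 := by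
      refine lintegral_congr_ae ?_
      filter_upwards [ae_restrict_mem measurableSet_Ioo] with τ hτ
      rw [ENNReal.ofReal_rpow_of_nonneg (Real.sqrt_nonneg _) (by norm_num),
        Real.rpow_two, Real.sq_sqrt (hpos τ hτ).le]
    have hsq2 : ∫⁻ τ, ENNReal.ofReal (h k τ / Real.sqrt (g τ)) ^ (2 : ℝ) ∂μ =
        ∫⁻ τ, ENNReal.ofReal (h k τ ^ 2 / g τ) ∂μ := by
      refine lintegral_congr_ae ?_
      filter_upwards [ae_restrict_mem measurableSet_Ioo] with τ hτ
      rw [ENNReal.ofReal_rpow_of_nonneg (div_nonneg (hh0 k τ) (Real.sqrt_nonneg _)) (by norm_num),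
        Real.rpow_two, div_pow, Real.sq_sqrt (hpos τ hτ).le]
    rw [h1, h2]
    calc (∫⁻ τ, ((fun τ => ENNReal.ofReal (Real.sqrt (g τ))) * fun τ =>
            ENNReal.ofReal (h k τ / Real.sqrt (g τ))) τ ∂μ) ^ 2
        ≤ ((∫⁻ τ, ENNReal.ofReal (Real.sqrt (g τ)) ^ (2 : ℝ) ∂μ) ^ (1 / (2 : ℝ)) *
            (∫⁻ τ, ENNReal.ofReal (h k τ / Real.sqrt (g τ)) ^ (2 : ℝ) ∂μ) ^ (1 / (2 : ℝ))) ^ 2 := by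
          gcongr
      _ = 𝔊 * ∫⁻ τ, ENNReal.ofReal (h k τ ^ 2 / g τ) ∂μ := by
          rw [hsq1, hsq2, mul_pow, ← ENNReal.rpow_natCast, ← ENNReal.rpow_natCast,
            ← ENNReal.rpow_mul, ← ENNReal.rpow_mul]
          norm_num
  -- Parseval, slice by slice: `Σₖ h(k,τ)²/g(τ) ≤ n⁴ g(τ)`
  have hpars : ∀ τ ∈ Ioo t₀ t, ∑' k : d → ℤ, ENNReal.ofReal (h k τ ^ 2 / g τ) ≤
      ENNReal.ofReal (n ^ 4 * g τ) := by
    intro τ hτ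
    have hgτ : 0 < g τ := hpos τ hτ
    -- discrete Cauchy–Schwarz: `h² ≤ n² Σⱼₗ |Tⱼₗ|²`
    have hdisc : ∀ k, h k τ ^ 2 ≤ n * n * ∑ j, ∑ l, ‖T j l k τ‖ ^ 2 := by
      intro k
      have h1 : h k τ = ∑ p ∈ (Finset.univ : Finset d) ×ˢ (Finset.univ : Finset d), ‖T p.1 p.2 k τ‖ := by
        rw [hhdef, Finset.sum_product]
      have h2 : ∑ j, ∑ l, ‖T j l k τ‖ ^ 2 =
          ∑ p ∈ (Finset.univ : Finset d) ×ˢ (Finset.univ : Finset d), ‖T p.1 p.2 k τ‖ ^ 2 := by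
        rw [Finset.sum_product]
      rw [h1, h2]
      refine (sq_sum_le_card_mul_sum_sq).trans (le_of_eq ?_)
      rw [Finset.card_product, Finset.card_univ, hn]
      push_cast
      ring
    have hstep : ∀ k, ENNReal.ofReal (h k τ ^ 2 / g τ) ≤
        ENNReal.ofReal ((g τ)⁻¹ * (n * n)) * ∑ j, ∑ l, ENNReal.ofReal (‖T j l k τ‖ ^ 2) := by
      intro k
      have e1 : (∑ j, ∑ l, ENNReal.ofReal (‖T j l k τ‖ ^ 2)) =
          ENNReal.ofReal (∑ j, ∑ l, ‖T j l k τ‖ ^ 2) := by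
        rw [ENNReal.ofReal_sum_of_nonneg (fun j _ => Finset.sum_nonneg fun l _ => sq_nonneg _)]
        refine Finset.sum_congr rfl fun j _ => ?_
        rw [ENNReal.ofReal_sum_of_nonneg (fun l _ => sq_nonneg _)]
      rw [e1, ← ENNReal.ofReal_mul (by positivity)]
      refine ENNReal.ofReal_le_ofReal ?_
      rw [div_eq_inv_mul, mul_assoc]
      exact mul_le_mul_of_nonneg_left (hdisc k) (inv_nonneg.2 hgτ.le)
    calc ∑' k : d → ℤ, ENNReal.ofReal (h k τ ^ 2 / g τ)
        ≤ ∑' k : d → ℤ, ENNReal.ofReal ((g τ)⁻¹ * (n * n)) * ∑ j, ∑ l, ENNReal.ofReal (‖T j l k τ‖ ^ 2) :=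
          ENNReal.tsum_le_tsum hstep
      _ = ENNReal.ofReal ((g τ)⁻¹ * (n * n)) * ∑ j, ∑ l, ∑' k : d → ℤ, ENNReal.ofReal (‖T j l k τ‖ ^ 2) := by
          rw [ENNReal.tsum_mul_left]
          congr 1
          rw [Summable.tsum_finsetSum (fun j _ => ENNReal.summable)]
          refine Finset.sum_congr rfl fun j _ => ?_
          exact Summable.tsum_finsetSum (fun l _ => ENNReal.summable)
      _ ≤ ENNReal.ofReal ((g τ)⁻¹ * (n * n)) * ∑ _j : d, ∑ _l : d, ENNReal.ofReal (g τ ^ 2) := by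
          gcongr with j _ l _
          exact tsum_ofReal_norm_sq_mFourierCoeff_le (hPcont j l τ hτ) (hPle j l τ hτ)
      _ = ENNReal.ofReal (n ^ 4 * g τ) := by
          simp only [Finset.sum_const, Finset.card_univ, nsmul_eq_mul]
          have hc : ((Fintype.card d : ℕ) : ℝ≥0∞) = ENNReal.ofReal n := by
            rw [hn, ENNReal.ofReal_natCast]
          rw [hc, ← ENNReal.ofReal_mul hn0, ← ENNReal.ofReal_mul hn0,
            ← ENNReal.ofReal_mul (by positivity)]
          congr 1
          field_simp
  -- sum over the frequencies
  have hmeas_h2g : ∀ k, AEMeasurable (fun τ => ENNReal.ofReal (h k τ ^ 2 / g τ)) μ := fun k =>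
    (((hhm k).pow_const 2).aemeasurable.div hgm).ennreal_ofReal
  have hsum : ∑' k : d → ℤ, (if k = 0 then 0 else ENNReal.ofReal (Torus.freqNormSq k ^ (-1 : ℝ))) *
      ‖mFourierCoeff (EuclideanSpace.complexify ∘ D) k‖ₑ ^ 2 ≤
      ENNReal.ofReal (4 * π ^ 2 * n) * 𝔊 * (ENNReal.ofReal (n ^ 4) * 𝔊) := by
    calc ∑' k : d → ℤ, (if k = 0 then 0 else ENNReal.ofReal (Torus.freqNormSq k ^ (-1 : ℝ))) *
          ‖mFourierCoeff (EuclideanSpace.complexify ∘ D) k‖ₑ ^ 2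
        ≤ ∑' k : d → ℤ, ENNReal.ofReal (4 * π ^ 2 * n) *
            (𝔊 * ∫⁻ τ, ENNReal.ofReal (h k τ ^ 2 / g τ) ∂μ) := by
          refine ENNReal.tsum_le_tsum fun k => ?_
          by_cases hk : k = 0
          · simp [hk]
          · rw [if_neg hk]
            exact (hterm k hk).trans (mul_le_mul' le_rfl (hCS k))
      _ = ENNReal.ofReal (4 * π ^ 2 * n) * 𝔊 * ∑' k : d → ℤ, ∫⁻ τ, ENNReal.ofReal (h k τ ^ 2 / g τ) ∂μ := by
          rw [ENNReal.tsum_mul_left, ENNReal.tsum_mul_left]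
          ring
      _ = ENNReal.ofReal (4 * π ^ 2 * n) * 𝔊 * ∫⁻ τ, ∑' k : d → ℤ, ENNReal.ofReal (h k τ ^ 2 / g τ) ∂μ := by
          rw [lintegral_tsum hmeas_h2g]
      _ ≤ ENNReal.ofReal (4 * π ^ 2 * n) * 𝔊 * ∫⁻ τ, ENNReal.ofReal (n ^ 4 * g τ) ∂μ := by
          gcongr ENNReal.ofReal (4 * π ^ 2 * n) * 𝔊 * ?_
          refine lintegral_mono_ae ?_
          filter_upwards [ae_restrict_mem measurableSet_Ioo] with τ hτ using hpars τ hτ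
      _ = ENNReal.ofReal (4 * π ^ 2 * n) * 𝔊 * (ENNReal.ofReal (n ^ 4) * 𝔊) := by
          congr 1
          rw [← lintegral_const_mul' _ _ ENNReal.ofReal_ne_top]
          refine lintegral_congr_ae ?_
          filter_upwards [ae_restrict_mem measurableSet_Ioo] with τ hτ
          rw [ENNReal.ofReal_mul (by positivity)]
  -- conclude
  have hfinal : ENNReal.ofReal (4 * π ^ 2 * n) * 𝔊 * (ENNReal.ofReal (n ^ 4) * 𝔊) ≤
      ENNReal.ofReal (2 * π * n ^ 3 * G) ^ 2 := by
    rw [h𝔊, ← ENNReal.ofReal_mul (by positivity), ← ENNReal.ofReal_mul (by positivity),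
      ← ENNReal.ofReal_mul (by positivity), ← ENNReal.ofReal_pow (by positivity)]
    refine ENNReal.ofReal_le_ofReal ?_
    have hn1 : n ^ 5 ≤ n ^ 6 := by
      rcases Nat.eq_zero_or_pos (Fintype.card d) with h0 | h0
      · simp [hn, h0]
      · exact pow_le_pow_right₀ (by rw [hn]; exact_mod_cast h0) (by norm_num)
    have key : (2 * π * n ^ 3 * G) ^ 2 - 4 * π ^ 2 * n * G * (n ^ 4 * G) =
        4 * π ^ 2 * G ^ 2 * (n ^ 6 - n ^ 5) := by ring
    have hnn : 0 ≤ 4 * π ^ 2 * G ^ 2 * (n ^ 6 - n ^ 5) :=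
      mul_nonneg (by positivity) (sub_nonneg.2 hn1)
    linarith
  unfold Torus.eHomSobolevSeminorm
  calc (∑' k : d → ℤ, (if k = 0 then 0 else ENNReal.ofReal (Torus.freqNormSq k ^ (-1 : ℝ))) *
        ‖mFourierCoeff (EuclideanSpace.complexify ∘ D) k‖ₑ ^ 2) ^ (1 / 2 : ℝ)
      ≤ (ENNReal.ofReal (2 * π * n ^ 3 * G) ^ 2) ^ (1 / 2 : ℝ) := by
        gcongr
        exact hsum.trans hfinal
    _ = ENNReal.ofReal (2 * π * n ^ 3 * G) := by
        rw [← ENNReal.rpow_natCast, ← ENNReal.rpow_mul]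
        norm_num

end Torus

end Literature.Analysis.FluidPDE
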